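import Summits.QuantumFields.YangMills.Theorems.BalabanUVNodesN20CutDialElimination
import Summits.QuantumFields.YangMills.Theorems.BalabanUVNodesK3V5Defs

/-!
# BalabanUVNodes ∕ N20 (NE7b) — THE CUT DIAL OF K3⁷ v5 STUB 2 IS ELIMINABLE, AT THE v5 STUB TEXTS BY NAME (`Thm/BalabanUVNodesK3V5Defs`, p606160): `stub_expansion13H`'s TEXT
# «∀ β 𝔯 ksel ℓ ℓ₃ g B, GuardedReadingN16 … → KeyedRatesHolderD4 β (rrOfRecord 𝔯 ksel) → ∃ jc sh cr, PinnedAtLive jc sh cr ∧ KeyedRelWeight cr ∧ KeyedShellWeight cr ∧ KeyedExtraction cr ∧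
# KeyedCoreEdgeHolderD4 β cr (rrOfRecord 𝔯 ksel)» ⟺ THE SAME TEXT WITH THE ZERO CUT READING `jc := fun _ _ _ _ _ _ ↦ 0`; and THE ITEM from stub 1's text + the zero-cut text

Cell `pub-ymgap` (HUMAN RULING D-0062 Track A; work-bound push D-0149, director-ym №197), width seat `pub-ymgap-dag-n20-w1` (gen 5) on node N20 = NE7b; key item K3⁷
`SpineGivenEndpointR13SepCoPH` = stmt-QuantumFields-20544 (`--kind proof --supports 20544 --as helper`); COUNT-NEUTRAL.  Bus: CLAIM-9 ∕ INTENT-13 (INBOX l.30022).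

WHY.  This seat's g4 (`…N20CutDialElimination`, p606432) proved `stubTwoBody_iff_zeroCut`: the five-conjunct BODY of K3⁷ v5 `stub_expansion13H` (shapes spelled out, generic in `N`,
the guard `G`, the live predicate `Live` and the rates premise `Prem`) is EQUIVALENT to its zero-cut specialisation — a budget-free fold.  Plan g83 BOOKED it as v6 input (3)
(WORDS-1b l.29306 ∕ WORDS-4b l.29679: «v6 MAY replace `∃ (jc : CutReading)` by the zero cut reading with your iff as the v5→v6 adapter»).  Since then dag-n27-w1 landed the BY-NAME
MIRROR of the v5 texts, `Thm/BalabanUVNodesK3V5Defs` (p606160; namespace `Summit.QuantumFields.YangMills.Theorems.K3V5Defs`: `CutReading`, `SpineReading`, `RateReadingFn`, `RunSel`,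
`LetterReading`, `rrOfRecord`, `PHolderD4`, `KeyedRatesHolderD4`, `GuardedReadingN16`, `KeyedRelWeight`, `KeyedShellWeight`, `KeyedExtraction`, `KeyedCoreEdgeHolderD4`, `LiveSel`,
`PinnedAtLive`, and the composition `spineGivenEndpointR13SepCoPH_of_stubTexts`).  THIS FILE instantiates g4's iff AT THOSE NAMES (`N := 2`, `G := ZhUnity ∧ SlotsNondegenerate₁₃`,
`Live := LiveSel`, `Prem := PHolderD4 β (datumOfRecord₁₃CoPH F 2 θ hP) (rrOfRecord 𝔯 ksel F θ hP g₀ os)` — all by `δ`-unfolding, no re-typing), lifts it through the stub's prefix, and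
records the composition of THE ITEM from stub 1's registered text and the ZERO-CUT text of stub 2 — so a v6 that drops `∃ jc` is served by exactly the v5 producers, and conversely.
* ★ `stub2Body_iff_zeroCutBody` — for fixed `β`, `rr`: `(∃ jc sh cr, PinnedAtLive jc sh cr ∧ KeyedRelWeight cr ∧ KeyedShellWeight cr ∧ KeyedExtraction cr ∧ KeyedCoreEdgeHolderD4 β cr rr)
  ↔ (∃ sh cr, PinnedAtLive zeroCut sh cr ∧ …)` [bookkeeping].
* ★★ `stub2Text_iff_zeroCutText` — v5 `stub_expansion13H`'s registered TEXT (verbatim, in the mirror's names) ⟺ its zero-cut edition [bookkeeping].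
* ★ `spineGivenEndpointR13SepCoPH_of_stub1Text_of_zeroCutText` — ⊢ `Summit.QuantumFields.YangMills.Theses.BalabanUVNodes.SpineGivenEndpointR13SepCoPH` from stub 1's registered text and
  the zero-cut text of stub 2 (dag-n27-w1's `spineGivenEndpointR13SepCoPH_of_stubTexts` after the iff) [bookkeeping].  NO STUB IS PROVED HERE: both texts are HYPOTHESES.

HONEST FRAMING.  [bookkeeping] — three one-line instances of landed theorems (g4's iff, n27-w1's composition); an EQUIVALENCE OF HYPOTHESIS SHAPES and a CONDITIONAL composition; neither
stub text is inhabited here, no witness is built from Bałaban's objects (K3⁷ stubs 1 and 2 OPEN; K0⁷ open); proves NO estimate; nothing of Bałaban's asserted.  NE7 ∕ NE7b ∕ NE7c NOT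
PRINTED for `d = 4`, NOT proved; N19 ∕ N20 ∕ N21 ∕ N27 NOT discharged; K3⁷ NOT closed, NOT claimed; skeleton v5 941dddb108cbaacf UNTOUCHED (the zero-cut text is NOT registered — a
located v6 input, decided by the plan); counts unmoved (typed 28∕28 · discharged 5∕27); no count claim.  One finite `𝕋⁴_{L^K}` programme at fixed `ε = L^{−K}`, Bałaban AS PRINTED;
the YM mass gap (Clay) is NOT proved by any of this — R4 closes the conditional finite-𝕋⁴ rung `BalabanLadder.UV` only; NOT ℝ⁴, NOT OS.  Gate note: `lint.theses-cone` WARNING is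
inherited from importing the by-name mirror `K3V5Defs` (which imports the route file by design), exactly as for dag-n20-w3's ∕ dag-n20-w5's `…StubText` companions.  No `def`, no
`instance`, no `notation`, no `sorry`.  Sources (bookkeeping only): [Balaban1988Convergent] (2.18) p.257, (3.23) p.270; [Balaban1989LargeFieldII] (1.80) p.384; [Balaban1987RG1] Thm 2 p.259.
-/

set_option autoImplicit false

noncomputable section

namespace Summit.QuantumFields.YangMills.BalabanUVNodes.N20CutDialStubText

open Literature.MathematicalPhysics.QuantumFieldTheory.Balaban1983to89
open Literature.MathematicalPhysics.QuantumFieldTheory.Balaban1983to89.T4Continuum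
open Literature.MathematicalPhysics.QuantumFieldTheory.Balaban1983to89.Node00
open YMDAG.UVSplit hiding SU
open Summit.QuantumFields.YangMills.Theorems.K3V5Defs
open Summit.QuantumFields.YangMills.BalabanUVNodes.N20CutDialElimination (stubTwoBody_iff_zeroCut)

/-- **THE ZERO CUT READING** is the cut-policy reading `fun _ _ _ _ _ _ ↦ 0` (no large-field class is ever declared bad).  Spelled inline below; this abbreviation-free lemma records
that it is pointwise `0`. [bookkeeping] -/
theorem zeroCut_apply (F : T4Family) (θ : Stage13HParams F 2) (hP : θ.Provisos₁₃CoPH F 2) (g₀ : ℕ → ℝ) (os : List (ULoop F)) (K : ℕ) :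
    (fun (F : T4Family) (θ : Stage13HParams F 2) (_ : θ.Provisos₁₃CoPH F 2) (_ : ℕ → ℝ) (_ : List (ULoop F)) (_ : ℕ) => (0 : ℕ) : CutReading) F θ hP g₀ os K = 0 := rfl

/-- ★ **THE STUB-2 BODY ⟺ ITS ZERO-CUT BODY, IN THE MIRROR'S NAMES** [bookkeeping]: for a fixed Hölder exponent `β` and rate reading `rr`, K3⁷ v5 `stub_expansion13H`'s conclusion
«`∃ jc sh cr, PinnedAtLive jc sh cr ∧ KeyedRelWeight cr ∧ KeyedShellWeight cr ∧ KeyedExtraction cr ∧ KeyedCoreEdgeHolderD4 β cr rr`» holds iff it holds WITH THE ZERO CUT READING.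
This is g4's `stubTwoBody_iff_zeroCut` at `N := 2`, `Live := LiveSel`, `G := ZhUnity ∧ SlotsNondegenerate₁₃`, `Prem := PHolderD4 β D (rr …)` (pure `δ`-unfolding of the mirror's `def`s). -/
theorem stub2Body_iff_zeroCutBody (β : ℝ) (rr : RateReadingFn) :
    (∃ (jc : CutReading) (sh : ShellSplit₁₃CoPH 2 0) (cr : SpineReading),
        PinnedAtLive jc sh cr ∧ KeyedRelWeight cr ∧ KeyedShellWeight cr ∧ KeyedExtraction cr ∧ KeyedCoreEdgeHolderD4 β cr rr) ↔
    (∃ (sh : ShellSplit₁₃CoPH 2 0) (cr : SpineReading),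
        PinnedAtLive (fun _ _ _ _ _ _ => 0) sh cr ∧ KeyedRelWeight cr ∧ KeyedShellWeight cr ∧ KeyedExtraction cr ∧ KeyedCoreEdgeHolderD4 β cr rr) :=
  stubTwoBody_iff_zeroCut LiveSel (fun F θ => θ.ZhUnity F 2 ∧ θ.SlotsNondegenerate₁₃ F 2)
    (fun F θ hP g₀ os => PHolderD4 β (datumOfRecord₁₃CoPH F 2 θ hP) (rr F θ hP g₀ os))

/-- ★★ **`stub_expansion13H`'s REGISTERED TEXT ⟺ ITS ZERO-CUT EDITION** [bookkeeping] (K3⁷ skeleton v5 941dddb108cbaacf; the text in dag-n27-w1's mirror names, verbatim = the `h₂`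
binder of `K3V5Defs.spineGivenEndpointR13SepCoPH_of_stubTexts`).  The zero-cut edition replaces `∃ (jc : CutReading)` by the zero cut reading and keeps every other letter. -/
theorem stub2Text_iff_zeroCutText :
    (∀ β : ℝ, 2 / 3 < β → β < 1 → ∀ (𝔯 : RateReading₁₃CoPH 2) (ksel : RunSel) (ℓ : LetterReading) (ℓ₃ : T4Family → Node00.NE3Letters₁₁) (g B : T4Family → ℝ),
      GuardedReadingN16 𝔯 ksel ℓ ℓ₃ g B → KeyedRatesHolderD4 β (rrOfRecord 𝔯 ksel) →
      ∃ (jc : CutReading) (sh : ShellSplit₁₃CoPH 2 0) (cr : SpineReading), PinnedAtLive jc sh cr ∧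
        KeyedRelWeight cr ∧ KeyedShellWeight cr ∧ KeyedExtraction cr ∧ KeyedCoreEdgeHolderD4 β cr (rrOfRecord 𝔯 ksel)) ↔
    (∀ β : ℝ, 2 / 3 < β → β < 1 → ∀ (𝔯 : RateReading₁₃CoPH 2) (ksel : RunSel) (ℓ : LetterReading) (ℓ₃ : T4Family → Node00.NE3Letters₁₁) (g B : T4Family → ℝ),
      GuardedReadingN16 𝔯 ksel ℓ ℓ₃ g B → KeyedRatesHolderD4 β (rrOfRecord 𝔯 ksel) →
      ∃ (sh : ShellSplit₁₃CoPH 2 0) (cr : SpineReading), PinnedAtLive (fun _ _ _ _ _ _ => 0) sh cr ∧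
        KeyedRelWeight cr ∧ KeyedShellWeight cr ∧ KeyedExtraction cr ∧ KeyedCoreEdgeHolderD4 β cr (rrOfRecord 𝔯 ksel)) :=
  forall₃_congr fun β _ _ => forall₅_congr fun 𝔯 ksel _ _ _ => forall_congr' fun _ => forall₂_congr fun _ _ =>
    stub2Body_iff_zeroCutBody β (rrOfRecord 𝔯 ksel)

/-- ★ **THE ITEM FROM STUB 1's TEXT AND THE ZERO-CUT TEXT OF STUB 2** [bookkeeping]: dag-n27-w1's by-name composition `spineGivenEndpointR13SepCoPH_of_stubTexts` after
`stub2Text_iff_zeroCutText`.  Both texts are HYPOTHESES; no stub is proved; the skeleton of record is untouched. -/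
theorem spineGivenEndpointR13SepCoPH_of_stub1Text_of_zeroCutText
    (h₁ : ∃ β : ℝ, 2 / 3 < β ∧ β < 1 ∧ ∃ (𝔯 : RateReading₁₃CoPH 2) (ksel : RunSel) (ℓ : LetterReading) (ℓ₃ : T4Family → Node00.NE3Letters₁₁) (g B : T4Family → ℝ),
      GuardedReadingN16 𝔯 ksel ℓ ℓ₃ g B ∧ KeyedRatesHolderD4 β (rrOfRecord 𝔯 ksel))
    (h₂z : ∀ β : ℝ, 2 / 3 < β → β < 1 → ∀ (𝔯 : RateReading₁₃CoPH 2) (ksel : RunSel) (ℓ : LetterReading) (ℓ₃ : T4Family → Node00.NE3Letters₁₁) (g B : T4Family → ℝ),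
      GuardedReadingN16 𝔯 ksel ℓ ℓ₃ g B → KeyedRatesHolderD4 β (rrOfRecord 𝔯 ksel) →
      ∃ (sh : ShellSplit₁₃CoPH 2 0) (cr : SpineReading), PinnedAtLive (fun _ _ _ _ _ _ => 0) sh cr ∧
        KeyedRelWeight cr ∧ KeyedShellWeight cr ∧ KeyedExtraction cr ∧ KeyedCoreEdgeHolderD4 β cr (rrOfRecord 𝔯 ksel)) :
    Summit.QuantumFields.YangMills.Theses.BalabanUVNodes.SpineGivenEndpointR13SepCoPH :=
  spineGivenEndpointR13SepCoPH_of_stubTexts h₁ (stub2Text_iff_zeroCutText.2 h₂z)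

end Summit.QuantumFields.YangMills.BalabanUVNodes.N20CutDialStubText

end
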